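import Mathlib.Analysis.Complex.Polynomial.Basic
import Mathlib.FieldTheory.IsAlgClosed.Basic
import Mathlib.Algebra.Polynomial.Derivative
import Mathlib.Algebra.Polynomial.Splits
import HarnessLib

/-!
# From a uniform Lee–Yang zero-free disc to a Lipschitz bound on the mean number of minus spins

Topic `Probability/LatticeModels`, namespace `Literature.Probability.LatticeModels.LeeYangRadii`
(continues `LeeYangRadii.lean`, but is logically independent of it). The elementary complex
algebra turning a ZERO-FREE DISC of radius `R > 1` for the one-variable activity polynomial of a
finite spin system into a LIPSCHITZ bound, uniform in the size of the system, for the mean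
number of minus spins near activity `1` — the finite-volume substitute for "analyticity of the
pressure implies differentiability" (Lee–Yang 1952, §V; Friedli–Velenik 2017, Theorem 3.42 and
§3.7.3) that avoids infinite-volume limits and complex function theory:

* `activityPoly w b = ∑_σ (w σ ∏_{k : σₖ = -} bₖ) X^{#{k : σₖ = -}}` — the partition function of the
  weight `w ≥ 0` with single-site activities `bₖ ω` as a polynomial in the common activity
  factor `ω` (`eval_activityPoly`: its value is the Lee–Yang sum `lySum w b ω =
  ∑_σ w σ ∏ₖ [σₖ ? 1 : bₖ ω]`; `eval_X_mul_derivative_activityPoly`: `ω Q'(ω)` is the sum weighted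
  by the number of minus spins).
* `minusMean w b ω = ⟨#{minus spins}⟩_ω` and `minusMean_eq` : `⟨#minus⟩_ω = ω Q'(ω)/Q(ω) =
  ∑_{roots z} ω/(ω - z)` (factorisation over `ℂ`, `Polynomial.Splits.eval_derivative_div_eval_of_ne_zero`).
* `norm_root_term_le` — for a root `|z| ≥ R > 1` and `|ω| ≤ (1+R)/2`:
  `|ω/(ω-z) - 1/(1-z)| = |z||1-ω|/(|ω-z||1-z|) ≤ 2R/(R-1)² · |1-ω|`.
* `abs_minusMean_sub_le` — **if `lySum w b` has no zero in `‖ω‖ < R` (`R > 1`) then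
  `|⟨#minus⟩_ω - ⟨#minus⟩_1| ≤ #ι · 2R/(R-1)² · |ω - 1|` for real `|ω| ≤ (1+R)/2`**: every root
  has modulus `≥ R`, there are at most `#ι` of them, and each contributes a Lipschitz term.

Used by `Literature/Barriers/CriticalPhenomena/PositionSpaceRGNonGibbsianTypes.lean`. No named
facts; everything is proved.

## References

* T. D. Lee, C. N. Yang, Phys. Rev. 87 (1952) 410–419, §V and Appendix II [LeeYang1952].
* S. Friedli, Y. Velenik, *Statistical Mechanics of Lattice Systems* (CUP 2017), §3.7.3,
  Theorem 3.42 [FriedliVelenik2017].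
-/

noncomputable section

open scoped BigOperators
open Polynomial

namespace Literature.Probability.LatticeModels

namespace LeeYangRadii

variable {ι : Type*} [Fintype ι] [DecidableEq ι]

/-! ### The activity polynomial of a spin weight -/

omit [DecidableEq ι] in
/-- The number of minus (`false`) spins of a configuration. [folklore] -/
def minusCount (σ : ι → Bool) : ℕ := (Finset.univ.filter fun k => σ k = false).card

omit [DecidableEq ι] in
/-- `minusCount σ ≤ #ι`. [folklore] -/
theorem minusCount_le (σ : ι → Bool) : minusCount σ ≤ Fintype.card ι :=
  (Finset.card_filter_le _ _).trans (Finset.card_univ.le)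

/-- The Lee–Yang sum with single-site activities `bₖ ω`: `∑_σ w σ ∏ₖ [σₖ ? 1 : bₖ ω]`.
[cite: LeeYang1952, Appendix II] -/
def lySum (w : (ι → Bool) → ℝ) (b : ι → ℝ) (ω : ℂ) : ℂ :=
  ∑ σ : ι → Bool, (w σ : ℂ) * ∏ k, (if σ k then (1 : ℂ) else (b k : ℂ) * ω)

/-- The Lee–Yang sum weighted by the number of minus spins. [cite: LeeYang1952, §V] -/
def lyMinusSum (w : (ι → Bool) → ℝ) (b : ι → ℝ) (ω : ℂ) : ℂ :=
  ∑ σ : ι → Bool, (minusCount σ : ℂ) * ((w σ : ℂ) * ∏ k, (if σ k then (1 : ℂ) else (b k : ℂ) * ω))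

/-- **The mean number of minus spins** at the real activity factor `ω`:
`⟨#{k : σₖ = -}⟩_ω = ∑_σ #minus(σ) w σ ∏ₖ[σₖ ? 1 : bₖω] / ∑_σ w σ ∏ₖ[σₖ ? 1 : bₖω]`.
[cite: LeeYang1952, §V] -/
def minusMean (w : (ι → Bool) → ℝ) (b : ι → ℝ) (ω : ℝ) : ℝ :=
  (∑ σ : ι → Bool, (minusCount σ : ℝ) * (w σ * ∏ k, (if σ k then (1 : ℝ) else b k * ω))) /
    ∑ σ : ι → Bool, w σ * ∏ k, (if σ k then (1 : ℝ) else b k * ω)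

/-- **The activity polynomial** `Q = ∑_σ (w σ ∏_{k : σₖ = -} bₖ) X^{#minus(σ)} ∈ ℂ[X]`.
[cite: LeeYang1952, §V] -/
def activityPoly (w : (ι → Bool) → ℝ) (b : ι → ℝ) : ℂ[X] :=
  ∑ σ : ι → Bool, C (((w σ * ∏ k ∈ Finset.univ.filter (fun k => σ k = false), b k : ℝ) : ℂ)) *
    X ^ minusCount σ

omit [DecidableEq ι] in
/-- The monomial of a configuration: `∏ₖ [σₖ ? 1 : bₖ ω] = (∏_{k : σₖ = -} bₖ) ω^{#minus(σ)}`.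
[folklore] -/
theorem prod_ite_activity (σ : ι → Bool) (b : ι → ℝ) (ω : ℂ) :
    ∏ k, (if σ k then (1 : ℂ) else (b k : ℂ) * ω) =
      ((∏ k ∈ Finset.univ.filter (fun k => σ k = false), b k : ℝ) : ℂ) * ω ^ minusCount σ := by
  have h1 : ∏ k, (if σ k then (1 : ℂ) else (b k : ℂ) * ω) =
      ∏ k ∈ Finset.univ.filter (fun k => σ k = false), ((b k : ℂ) * ω) := by
    rw [Finset.prod_filter]
    refine Finset.prod_congr rfl fun k _ => ?_
    cases σ k <;> simp
  rw [h1, Finset.prod_mul_distrib, Finset.prod_const]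
  push_cast
  rfl

omit [DecidableEq ι] in
/-- The real form of the monomial identity. [folklore] -/
theorem prod_ite_activity_real (σ : ι → Bool) (b : ι → ℝ) (ω : ℝ) :
    ∏ k, (if σ k then (1 : ℝ) else b k * ω) =
      (∏ k ∈ Finset.univ.filter (fun k => σ k = false), b k) * ω ^ minusCount σ := by
  have h1 : ∏ k, (if σ k then (1 : ℝ) else b k * ω) =
      ∏ k ∈ Finset.univ.filter (fun k => σ k = false), (b k * ω) := by
    rw [Finset.prod_filter]
    refine Finset.prod_congr rfl fun k _ => ?_
    cases σ k <;> simp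
  rw [h1, Finset.prod_mul_distrib, Finset.prod_const]
  rfl

/-- `Q(ω)` is the Lee–Yang sum. [cite: LeeYang1952, §V] -/
theorem eval_activityPoly (w : (ι → Bool) → ℝ) (b : ι → ℝ) (ω : ℂ) :
    (activityPoly w b).eval ω = lySum w b ω := by
  unfold activityPoly lySum
  rw [eval_finsetSum]
  refine Finset.sum_congr rfl fun σ _ => ?_
  rw [eval_mul, eval_C, eval_pow, eval_X, prod_ite_activity]
  push_cast
  ring

/-- `ω Q'(ω)` is the Lee–Yang sum weighted by the number of minus spins. [cite: LeeYang1952, §V] -/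
theorem eval_X_mul_derivative_activityPoly (w : (ι → Bool) → ℝ) (b : ι → ℝ) (ω : ℂ) :
    ω * (derivative (activityPoly w b)).eval ω = lyMinusSum w b ω := by
  unfold activityPoly lyMinusSum
  rw [derivative_sum, eval_finsetSum, Finset.mul_sum]
  refine Finset.sum_congr rfl fun σ _ => ?_
  rw [derivative_C_mul_X_pow, eval_mul, eval_C, eval_pow, eval_X, prod_ite_activity]
  rcases Nat.eq_zero_or_pos (minusCount σ) with h0 | hpos
  · rw [h0]
    simp
  · have hpow : ω * ω ^ (minusCount σ - 1) = ω ^ minusCount σ := by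
      rw [← pow_succ', Nat.sub_add_cancel hpos]
    push_cast
    rw [← hpow]
    ring

/-- The degree of the activity polynomial is at most the number of sites. [folklore] -/
theorem natDegree_activityPoly_le (w : (ι → Bool) → ℝ) (b : ι → ℝ) :
    (activityPoly w b).natDegree ≤ Fintype.card ι := by
  unfold activityPoly
  refine natDegree_sum_le_of_forall_le _ _ fun σ _ => ?_
  exact (natDegree_C_mul_X_pow_le _ _).trans (minusCount_le σ)

/-- The mean number of minus spins is `ω Q'(ω) / Q(ω)` (as a complex number).
[cite: LeeYang1952, §V] -/
theorem minusMean_eq_div (w : (ι → Bool) → ℝ) (b : ι → ℝ) (ω : ℝ) :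
    (minusMean w b ω : ℂ) =
      (ω : ℂ) * (derivative (activityPoly w b)).eval (ω : ℂ) / (activityPoly w b).eval (ω : ℂ) := by
  rw [eval_X_mul_derivative_activityPoly, eval_activityPoly]
  unfold minusMean lyMinusSum lySum
  push_cast
  simp only [apply_ite Complex.ofReal, Complex.ofReal_one, Complex.ofReal_mul]

/-! ### Roots outside the disc and the Lipschitz bound -/

/-- **One root's contribution is Lipschitz near `ω = 1`.** For `R > 1`, `‖z‖ ≥ R` and
`‖ω‖ ≤ (1+R)/2`: `‖ω/(ω-z) - 1/(1-z)‖ ≤ 2R/(R-1)² · ‖1-ω‖` (since `ω/(ω-z) - 1/(1-z) =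
z(1-ω)/((ω-z)(1-z))`, `‖ω-z‖ ≥ ‖z‖(R-1)/(2R)` and `‖1-z‖ ≥ ‖z‖(R-1)/R`). [folklore] -/
theorem norm_root_term_le {R : ℝ} (hR : 1 < R) {z : ℂ} (hz : R ≤ ‖z‖) {ω : ℂ}
    (hω : ‖ω‖ ≤ (1 + R) / 2) :
    ‖ω / (ω - z) - 1 / (1 - z)‖ ≤ 2 * R / (R - 1) ^ 2 * ‖1 - ω‖ := by
  have hR0 : 0 < R := by linarith
  have hnz : 0 < ‖z‖ := by linarith
  have hA : ‖z‖ * (R - 1) / (2 * R) ≤ ‖ω - z‖ := by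
    have h1 : ‖z‖ - ‖ω‖ ≤ ‖ω - z‖ := by
      have := norm_sub_norm_le z ω
      rw [norm_sub_rev] at this
      linarith
    have h2 : (1 + R) / 2 ≤ ‖z‖ * (1 + R) / (2 * R) := by
      rw [div_le_div_iff₀ (by norm_num) (by positivity)]
      nlinarith
    have h3 : ‖z‖ * (R - 1) / (2 * R) = ‖z‖ - ‖z‖ * (1 + R) / (2 * R) := by
      field_simp
      ring
    linarith
  have hB : ‖z‖ * (R - 1) / R ≤ ‖1 - z‖ := by
    have h1 : ‖z‖ - 1 ≤ ‖1 - z‖ := by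
      have := norm_sub_norm_le z 1
      rw [norm_one, norm_sub_rev] at this
      linarith
    have h2 : (1 : ℝ) ≤ ‖z‖ / R := by rw [le_div_iff₀ hR0, one_mul]; exact hz
    have h3 : ‖z‖ * (R - 1) / R = ‖z‖ - ‖z‖ / R := by
      field_simp
    linarith
  have hApos : 0 < ‖ω - z‖ := lt_of_lt_of_le (by positivity) hA
  have hBpos : 0 < ‖1 - z‖ := lt_of_lt_of_le (by positivity) hB
  have hωz : ω - z ≠ 0 := norm_pos_iff.1 hApos
  have h1z : 1 - z ≠ 0 := norm_pos_iff.1 hBpos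
  have hid : ω / (ω - z) - 1 / (1 - z) = z * (1 - ω) / ((ω - z) * (1 - z)) := by
    field_simp
    ring
  rw [hid, norm_div, norm_mul, norm_mul, div_le_iff₀ (mul_pos hApos hBpos)]
  -- `‖z‖ ‖1-ω‖ ≤ 2R/(R-1)² ‖1-ω‖ ‖ω-z‖ ‖1-z‖`
  have hprod : ‖z‖ ^ 2 * (R - 1) ^ 2 / (2 * R ^ 2) ≤ ‖ω - z‖ * ‖1 - z‖ := by
    have := mul_le_mul hA hB (by positivity) hApos.le
    have e : ‖z‖ * (R - 1) / (2 * R) * (‖z‖ * (R - 1) / R) = ‖z‖ ^ 2 * (R - 1) ^ 2 / (2 * R ^ 2) := by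
      field_simp
    linarith
  have hkey : ‖z‖ ≤ 2 * R / (R - 1) ^ 2 * (‖ω - z‖ * ‖1 - z‖) := by
    have hR1 : R - 1 ≠ 0 := ne_of_gt (by linarith)
    calc ‖z‖ ≤ ‖z‖ ^ 2 / R := by
          rw [le_div_iff₀ hR0, sq]
          exact mul_le_mul_of_nonneg_left hz hnz.le
      _ = 2 * R / (R - 1) ^ 2 * (‖z‖ ^ 2 * (R - 1) ^ 2 / (2 * R ^ 2)) := by
          field_simp
      _ ≤ 2 * R / (R - 1) ^ 2 * (‖ω - z‖ * ‖1 - z‖) :=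
          mul_le_mul_of_nonneg_left hprod (by positivity)
  calc ‖z‖ * ‖1 - ω‖ ≤ 2 * R / (R - 1) ^ 2 * (‖ω - z‖ * ‖1 - z‖) * ‖1 - ω‖ :=
        mul_le_mul_of_nonneg_right hkey (norm_nonneg _)
    _ = 2 * R / (R - 1) ^ 2 * ‖1 - ω‖ * (‖ω - z‖ * ‖1 - z‖) := by ring

/-- **The sum over the roots.** If every root of `Q ≠ 0` (over `ℂ`) has modulus `≥ R > 1`, then for
`‖ω‖ ≤ (1+R)/2`, `‖∑_{roots z} (ω/(ω-z) - 1/(1-z))‖ ≤ deg Q · 2R/(R-1)² · ‖1-ω‖`. [folklore] -/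
theorem norm_sum_roots_sub_le {Q : ℂ[X]} {R : ℝ} (hR : 1 < R) (hroots : ∀ z ∈ Q.roots, R ≤ ‖z‖)
    {ω : ℂ} (hω : ‖ω‖ ≤ (1 + R) / 2) :
    ‖(Q.roots.map fun z => ω / (ω - z) - 1 / (1 - z)).sum‖ ≤
      Q.natDegree * (2 * R / (R - 1) ^ 2 * ‖1 - ω‖) := by
  calc ‖(Q.roots.map fun z => ω / (ω - z) - 1 / (1 - z)).sum‖
      ≤ ((Q.roots.map fun z => ω / (ω - z) - 1 / (1 - z)).map fun x => ‖x‖).sum :=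
        norm_multiset_sum_le _
    _ = (Q.roots.map fun z => ‖ω / (ω - z) - 1 / (1 - z)‖).sum := by
        rw [Multiset.map_map]; rfl
    _ ≤ (Q.roots.map fun _ => 2 * R / (R - 1) ^ 2 * ‖1 - ω‖).sum :=
        Multiset.sum_map_le_sum_map _ _ fun z hz => norm_root_term_le hR (hroots z hz) hω
    _ = Multiset.card Q.roots * (2 * R / (R - 1) ^ 2 * ‖1 - ω‖) := by
        rw [Multiset.map_const', Multiset.sum_replicate, nsmul_eq_mul]
    _ ≤ Q.natDegree * (2 * R / (R - 1) ^ 2 * ‖1 - ω‖) := by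
        refine mul_le_mul_of_nonneg_right ?_ (by positivity)
        exact_mod_cast Polynomial.card_roots' Q

/-- **From a zero-free disc to a Lipschitz bound on the mean number of minus spins.** Let
`w`, `b` be real, and suppose the Lee–Yang sum `∑_σ w σ ∏ₖ [σₖ ? 1 : bₖ ω]` has no zero in
the disc `‖ω‖ < R`, `R > 1`. Then for every real `ω` with `|ω| ≤ (1+R)/2`,
`|⟨#minus⟩_ω - ⟨#minus⟩_1| ≤ #ι · 2R/(R-1)² · |ω - 1|` — uniformly in everything but `R` and
the number of sites: `⟨#minus⟩_ω = ∑_{roots z} ω/(ω - z)` with all `|z| ≥ R`.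
[cite: LeeYang1952, §V] -/
theorem abs_minusMean_sub_le (w : (ι → Bool) → ℝ) (b : ι → ℝ) {R : ℝ}
    (hR : 1 < R) (hZ : ∀ ω : ℂ, ‖ω‖ < R → lySum w b ω ≠ 0) {ω : ℝ} (hω : |ω| ≤ (1 + R) / 2) :
    |minusMean w b ω - minusMean w b 1| ≤
      Fintype.card ι * (2 * R / (R - 1) ^ 2) * |ω - 1| := by
  set Q := activityPoly w b with hQ
  have hQeval : ∀ ω' : ℂ, ‖ω'‖ < R → Q.eval ω' ≠ 0 := fun ω' hω' => by
    rw [eval_activityPoly]; exact hZ ω' hω'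
  have hQ0 : Q ≠ 0 := fun h => hQeval 0 (by simpa using (zero_lt_one.trans hR)) (by rw [h, eval_zero])
  have hroots : ∀ z ∈ Q.roots, R ≤ ‖z‖ := by
    intro z hz
    by_contra hlt
    push Not at hlt
    exact hQeval z hlt ((mem_roots hQ0).1 hz)
  have hsplit : Q.Splits := IsAlgClosed.splits Q
  -- the complex activities `ω` and `1` lie in the zero-free disc
  have hωC : ‖(ω : ℂ)‖ ≤ (1 + R) / 2 := by rw [Complex.norm_real]; exact hω
  have hωR : ‖(ω : ℂ)‖ < R := lt_of_le_of_lt hωC (by linarith)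
  have h1R : ‖(1 : ℂ)‖ < R := by rw [norm_one]; exact hR
  have hne : Q.eval (ω : ℂ) ≠ 0 := hQeval _ hωR
  have hne1 : Q.eval (1 : ℂ) ≠ 0 := hQeval _ h1R
  -- `⟨#minus⟩ = ω Q'/Q = ∑ ω/(ω - z)`
  have hmean : ∀ {x : ℝ}, Q.eval (x : ℂ) ≠ 0 →
      (minusMean w b x : ℂ) = (Q.roots.map fun z => (x : ℂ) / ((x : ℂ) - z)).sum := by
    intro x hx
    rw [minusMean_eq_div, ← hQ, mul_div_assoc, hsplit.eval_derivative_div_eval_of_ne_zero hx,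
      ← Multiset.sum_map_mul_left]
    congr 1
    refine Multiset.map_congr rfl fun z _ => ?_
    rw [mul_one_div]
  have hdiff : ((minusMean w b ω - minusMean w b 1 : ℝ) : ℂ) =
      (Q.roots.map fun z => (ω : ℂ) / ((ω : ℂ) - z) - 1 / (1 - z)).sum := by
    push_cast
    rw [hmean hne, Multiset.sum_map_sub]
    have h1 := hmean (x := 1) (by exact_mod_cast hne1)
    push_cast at h1
    rw [h1]
  have hbound := norm_sum_roots_sub_le hR hroots hωC
  rw [← hdiff, Complex.norm_real, Real.norm_eq_abs] at hbound
  have hdeg : (Q.natDegree : ℝ) ≤ Fintype.card ι := by exact_mod_cast natDegree_activityPoly_le w b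
  have h1ω : ‖(1 : ℂ) - ω‖ = |ω - 1| := by
    rw [← Complex.ofReal_one, ← Complex.ofReal_sub, Complex.norm_real, Real.norm_eq_abs, abs_sub_comm]
  rw [h1ω] at hbound
  calc |minusMean w b ω - minusMean w b 1|
      ≤ Q.natDegree * (2 * R / (R - 1) ^ 2 * |ω - 1|) := hbound
    _ ≤ Fintype.card ι * (2 * R / (R - 1) ^ 2 * |ω - 1|) :=
        mul_le_mul_of_nonneg_right hdeg (by positivity)
    _ = Fintype.card ι * (2 * R / (R - 1) ^ 2) * |ω - 1| := by ring

end LeeYangRadii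

end Literature.Probability.LatticeModels

end
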